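import Literature.Computability.MetaComplexity.ConstructiveSeparationsProofs
import Literature.Computability.Complexity.OnesZeroPadding
import Literature.Computability.Complexity.ReductionsProofs
import Literature.Computability.Complexity.NPClosureProofs
import Literature.Computability.Complexity.CodeFPOfUnary
import HarnessLib

/-!
# Refuters for every `NP`-complete language: the padding hypothesis of Gutfreund–Shaltiel–Ta-Shma / Chen–Jin–Santhanam–Williams Thm. 1.2 discharged

Topic `Literature/Computability/MetaComplexity`; companion of `ConstructiveSeparations.lean` and
`ConstructiveSeparationsProofs.lean` (L. Chen, C. Jin, R. Santhanam, R. Williams, *Constructive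
separations and their consequences*, FOCS 2021 = arXiv:2203.14379v5, Def. 1.1, Thm. 1.2
[ChenEtAl2022]; D. Gutfreund, R. Shaltiel, A. Ta-Shma, *If NP languages are hard on the worst-case,
then it is easy to find their hard instances*, Comput. Complexity 16 (2007) 412–441, Thm. 1.1 /
Thm. 3.1 [GutfreundShaltielTashma2007]). Everything here is PROVED; no named fact is introduced.

The tree's discharge `pConstructiveSeparation_of_not_NP_subset_P_holds` of Thm. 1.2 for
`(𝒞, 𝒟) = (P, NP)` carries the printed hypothesis that the `NP`-complete language be
LENGTH-PADDABLE (`IsLengthPaddable`, §5.1), and no language of the tree was shown to be so. This file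
supplies the instance and removes the hypothesis where it is inessential:

* `isLengthPaddable_onesZeroPad` — Santhanam's padding `onesZeroPad S = {1ⁱ 0 x : x ∈ S}`
  (`OnesZeroPadding.lean`, after Murray–Williams 2018, Thm. 2.2) is length-paddable for EVERY `S`:
  `pad (z, m) = 1^{m - |z|} z` (`OnesZeroPad.replicate_append_mem_iff'`), computed on codes by the
  `CodeFP` algebra (`codeFP_onesZeroPad_pad`).
* `onesZeroPad_mem_NP`, `isNPComplete_onesZeroPad` — `NP`-membership and `NP`-completeness transfer
  to the padding (`OnesZeroPad.eq_inter_preimage`, `OnesZeroPad.isHard`); so length-paddable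
  `NP`-complete languages EXIST (`exists_isNPComplete_isLengthPaddable`, e.g. `onesZeroPad SAT`).
* `hasPConstructiveSeparation_onesZeroPad` — Thm. 1.2 / GST for the padding of any `NP`-complete `S`:
  if `NP ⊄ P`, every `L'' ∈ P` is refuted on `onesZeroPad S` by a `P`-refuter (exact-length form).
* `exists_refuter_of_isNPComplete` — **the padding hypothesis removed** at the price of the
  exact-length clause of Def. 1.1: if `NP ⊄ P` and `S` is ANY `NP`-complete language, then for every
  `D ∈ P` there is a polynomial-time `R : 1ⁿ ↦ R n` with `|R n| ≤ n` and `R n ∈ S ∆ D` for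
  infinitely many `n` (refute the `P`-language `{z : z has a 0 ∧ payload z ∈ D}` on `onesZeroPad S`
  and strip the padding). This is the form of GST's Thm. 1.1 ("hard instances of SAT are easy to
  find") for an arbitrary complete problem.
* `not_NP_subset_P_iff_refuters`, `not_NP_subset_P_iff_hasPConstructiveSeparation` — hence, for
  `NP`-complete `S`: `NP ⊄ P` **iff** every
  polynomial-time heuristic for `S` is refuted infinitely often by a polynomial-time instance
  generator. The separation `P ≠ NP`, if true, is automatically constructive; contrast Thm. 1.9
  (`exists_NP_diff_P_without_PRefuter_of_not_NE_subset_ioE`, `ConstructiveSeparationsNoRefuter.lean`):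
  under `NE ⊄ io-E` some language of `NP ∖ P` has no refuter at all — constructivity is a property of
  COMPLETE problems.

## References

* [ChenEtAl2022] Def. 1.1, Thm. 1.2, §5.1 (paddability), Thm. 1.9.
* [GutfreundShaltielTashma2007] Thm. 1.1, Thm. 3.1 (deterministic heuristics), §3.
* C. D. Murray, R. R. Williams, SIAM J. Comput. 49 (2020), Thm. 2.7 (the padding `{1ⁱ 0 x}`).
* S. Arora, B. Barak, *Computational Complexity: A Modern Approach*, CUP 2009, Thm. 2.8 (closure of
  `NP` under Karp reductions), Def. 2.7.
-/

namespace Literature.Computability.MetaComplexity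

open _root_.Computability Literature.Computability.Complexity Filter CodeFP

/-! ### Santhanam's padding is length-paddable

(No new definitions: the padding map `pad (z, m) = (1ᵐ ⇂ |z|) ++ z = 1^{m-|z|} z` and the payload
map `z ↦ (stripOnes z) ⇂ 1` are written out as terms.) -/

/-- `(1ᵐ ⇂ |z|) ++ z = 1^{m - |z|} z`. [folklore] -/
theorem unE_drop_append_eq (z : List Bool) (m : ℕ) :
    (unE m).drop z.length ++ z = List.replicate (m - z.length) true ++ z := by
  simp [unE_eq_ones, ones, List.drop_replicate]

/-- The padding map `⟨z, 1ᵐ⟩ ↦ (1ᵐ ⇂ |z|) ++ z` is computed on codes by a polynomial-time string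
function (`CodeFP` algebra: `strLength`, `strOfUn`, `strDrop`, `strAppend`). [cite: AroraBarak2009, §1.3] -/
theorem codeFP_onesZeroPad_pad :
    CodeFP (pairE strE unE) strE (fun p : List Bool × ℕ => (unE p.2).drop p.1.length ++ p.1) :=
  (strAppend.comp ((strDrop.comp ((strLength.comp (CodeFP.fst strE unE)).pair
    (strOfUn.comp (CodeFP.snd strE unE)))).pair (CodeFP.fst strE unE))).congr fun _ => rfl

/-- **`onesZeroPad S` is length-paddable, for every `S`**: prepend `1`s
(`OnesZeroPad.replicate_append_mem_iff'`), `pad (z, m) = 1^{m-|z|} z`.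
[cite: ChenEtAl2022, §5.1 (paddable complete languages)] -/
theorem isLengthPaddable_onesZeroPad (S : Language Bool) : IsLengthPaddable (onesZeroPad S) := by
  refine ⟨fun p : List Bool × ℕ => (unE p.2).drop p.1.length ++ p.1, ?_, fun z m hzm => ?_⟩
  · have h := codeFP_onesZeroPad_pad.polyTimeComputable
    exact h
  · dsimp only
    rw [unE_drop_append_eq]
    refine ⟨?_, OnesZeroPad.replicate_append_mem_iff' _ _⟩
    simp only [List.length_append, List.length_replicate]
    omega

/-! ### `NP`-completeness transfers to the padding -/

/-- `S ∈ NP ⟹ onesZeroPad S ∈ NP` (a `P`-set cut down by an `FP`-preimage of `S`,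
`OnesZeroPad.eq_inter_preimage`; `NP` is closed under both). [cite: AroraBarak2009, Thm. 2.8] -/
theorem onesZeroPad_mem_NP {S : Language Bool} (h : S ∈ Nondeterministic.NP) :
    onesZeroPad S ∈ Nondeterministic.NP := by
  rw [OnesZeroPad.eq_inter_preimage]
  exact inter_P_mem_polyExists (fun _ _ h₁ h₂ => inter_mem_P h₁ h₂) OnesZeroPad.hasZero_mem_P
    (preimage_mem_NP h OnesZeroPad.payload_mem_FP)

/-- **`NP`-completeness transfers to the padding** (`x ↦ 0x` reduces `S` to it).
[cite: AroraBarak2009, Def. 2.7, Thm. 2.8] -/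
theorem isNPComplete_onesZeroPad {S : Language Bool} (h : IsNPComplete S) :
    IsNPComplete (onesZeroPad S) :=
  ⟨onesZeroPad_mem_NP h.mem, OnesZeroPad.isHard h.isHard⟩

/-- **Length-paddable `NP`-complete languages exist** (given any `NP`-complete language, e.g. the
tree's `SAT`, `isNPComplete_SAT_holds`): the hypothesis of Thm. 1.2 is not vacuous in this tree.
[cite: ChenEtAl2022, Thm. 1.2] -/
theorem exists_isNPComplete_isLengthPaddable {S : Language Bool} (h : IsNPComplete S) :
    ∃ L : Language Bool, IsNPComplete L ∧ IsLengthPaddable L :=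
  ⟨onesZeroPad S, isNPComplete_onesZeroPad h, isLengthPaddable_onesZeroPad S⟩

/-! ### Refuters -/

/-- **Thm. 1.2 / GST for the padding of an `NP`-complete language** (exact-length refuters): if
`NP ⊄ P` then every `L'' ∈ P` admits a `P`-refuter for `onesZeroPad S`.
[cite: ChenEtAl2022, Thm. 1.2] [cite: GutfreundShaltielTashma2007, Thm. 1.1] -/
theorem hasPConstructiveSeparation_onesZeroPad (hNP : ¬ Nondeterministic.NP ⊆ Classes.P)
    {S : Language Bool} (hS : IsNPComplete S) :
    HasPConstructiveSeparation (onesZeroPad S) Classes.P :=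
  pConstructiveSeparation_of_not_NP_subset_P_holds hNP _ (isNPComplete_onesZeroPad hS)
    (isLengthPaddable_onesZeroPad S)

/-- The payload `(stripOnes z) ⇂ 1` (`1ⁱ 0 x ↦ x`, `1ⁱ ↦ ε`) is never longer than the word. [folklore] -/
theorem length_stripOnes_drop_one_le (z : List Bool) :
    ((MWProtocol.stripOnes z).drop 1).length ≤ z.length := by
  rcases MWProtocol.eq_replicate_or_exists z with ⟨hz, hs⟩ | ⟨a, x, hz, hs⟩
  · rw [hs]; simp
  · rw [hs, hz]; simp; omega

/-- **The stripped refuter is polynomial time.** For `R₀` polynomial time on `1ⁿ`, so is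
`n ↦ payload (R₀ n)` if `|R₀ n| = n`, else `ε` (sanitise-and-run bridge
`CodeFP.ofPolyTimeComputable_unE`, then the `CodeFP` algebra). [cite: AroraBarak2009, §1.3] -/
theorem polyTimeComputable_stripRefuter {R₀ : ℕ → List Bool}
    (h : PolyTimeComputable unaryEncodeNat (id : List Bool → List Bool) R₀) :
    PolyTimeComputable unaryEncodeNat (id : List Bool → List Bool)
      (fun n => if decide ((R₀ n).length = n) then (MWProtocol.stripOnes (R₀ n)).drop 1 else []) := by
  have hR₀ : CodeFP unE strE R₀ := CodeFP.ofPolyTimeComputable_unE h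
  have hpay : CodeFP strE strE (fun z => (MWProtocol.stripOnes z).drop 1) :=
    CodeFP.of_fn _ OnesZeroPad.payload_mem_FP fun _ => rfl
  have hC : CodeFP unE strE
      (fun n => if decide ((R₀ n).length = n) then (MWProtocol.stripOnes (R₀ n)).drop 1 else []) :=
    (CodeFP.ite (((CodeFP.eq unE_injective).comp ((strLength.comp hR₀).pair (CodeFP.id unE))).congr
        fun _ => rfl)
      (hpay.comp hR₀) (CodeFP.const unE (eβ := strE) ([] : List Bool))).congr fun _ => rfl
  exact hC.polyTimeComputable

/-- **Refuters for an arbitrary `NP`-complete language (no paddability hypothesis).** If `NP ⊄ P`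
and `S` is `NP`-complete, then against every `D ∈ P` there is a polynomial-time `R` (on the unary
input `1ⁿ`) with `|R n| ≤ n` whose output lies in `S ∆ D` for infinitely many `n`: take a
`P`-refuter `R₀` for `onesZeroPad S` against `D' = {z : z has a 0 ∧ payload z ∈ D} ∈ P` and output
the payload of `R₀ n`. [cite: GutfreundShaltielTashma2007, Thm. 1.1 / Thm. 3.1]
[cite: ChenEtAl2022, Thm. 1.2] -/
theorem exists_refuter_of_isNPComplete (hNP : ¬ Nondeterministic.NP ⊆ Classes.P)
    {S : Language Bool} (hS : IsNPComplete S) {D : Language Bool} (hD : D ∈ Classes.P) :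
    ∃ R : ℕ → List Bool, PolyTimeComputable unaryEncodeNat (id : List Bool → List Bool) R ∧
      (∀ n, (R n).length ≤ n) ∧ ∃ᶠ n in atTop, (R n ∈ S ↔ R n ∉ D) := by
  classical
  -- the refuted `P`-language on padded words
  set D' : Language Bool := ({z : List Bool | MWProtocol.stripOnes z ≠ []} : Language Bool) ⊓
    ((fun z => (MWProtocol.stripOnes z).drop 1) ⁻¹' D : Language Bool) with hD'
  have hD'P : D' ∈ Classes.P :=
    inter_mem_P OnesZeroPad.hasZero_mem_P (preimage_mem_P hD OnesZeroPad.payload_mem_FP)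
  obtain ⟨R₀, hR₀, hfreq⟩ := hasPConstructiveSeparation_onesZeroPad hNP hS D' hD'P
  refine ⟨fun n => if decide ((R₀ n).length = n) then (MWProtocol.stripOnes (R₀ n)).drop 1 else [],
    polyTimeComputable_stripRefuter hR₀, fun n => ?_, ?_⟩
  · dsimp only
    split_ifs with h
    · exact (length_stripOnes_drop_one_le _).trans (of_decide_eq_true h).le
    · simp
  · refine hfreq.mono fun n hn => ?_
    obtain ⟨hlen, hiff⟩ := hn
    simp only [hlen, decide_true, if_true]
    -- at a success event the word has a `0` (else both sides of `hiff` fail) and the padded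
    -- membership is the payload's
    have hmemS : R₀ n ∈ onesZeroPad S ↔
        MWProtocol.stripOnes (R₀ n) ≠ [] ∧ (MWProtocol.stripOnes (R₀ n)).drop 1 ∈ S := by
      rw [OnesZeroPad.eq_inter_preimage]; rfl
    have hmemD : R₀ n ∈ D' ↔
        MWProtocol.stripOnes (R₀ n) ≠ [] ∧ (MWProtocol.stripOnes (R₀ n)).drop 1 ∈ D := Iff.rfl
    rw [hmemS, hmemD] at hiff
    by_cases hz : MWProtocol.stripOnes (R₀ n) = []
    · simp [hz] at hiff
    · simpa [hz] using hiff

/-- **For an `NP`-complete language, `NP ⊄ P` iff every polynomial-time heuristic is refutable in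
polynomial time, infinitely often** (`→`: `exists_refuter_of_isNPComplete`; `←`: refute `S` itself).
A proof of `P ≠ NP` therefore yields, for every polynomial-time algorithm, an efficient generator
of instances on which it errs. [cite: GutfreundShaltielTashma2007, Thm. 1.1] [cite: ChenEtAl2022, Thm. 1.2] -/
theorem not_NP_subset_P_iff_refuters {S : Language Bool} (hS : IsNPComplete S) :
    ¬ Nondeterministic.NP ⊆ Classes.P ↔
      ∀ D ∈ Classes.P, ∃ R : ℕ → List Bool,
        PolyTimeComputable unaryEncodeNat (id : List Bool → List Bool) R ∧
          (∀ n, (R n).length ≤ n) ∧ ∃ᶠ n in atTop, (R n ∈ S ↔ R n ∉ D) := by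
  constructor
  · exact fun hNP D hD => exists_refuter_of_isNPComplete hNP hS hD
  · intro h hsub
    obtain ⟨R, -, -, hR⟩ := h S (hsub hS.mem)
    obtain ⟨n, hn⟩ := hR.exists
    exact iff_not_self hn

/-- **The exact-length form, for every length-paddable `NP`-complete `L`, is EQUIVALENT to
`NP ⊄ P`** (Thm. 1.2's conclusion characterises the separation; `←` by
`not_mem_of_hasPConstructiveSeparation` at a paddable complete language, which exists by
`exists_isNPComplete_isLengthPaddable`). [cite: ChenEtAl2022, Thm. 1.2, Def. 1.1] -/
theorem not_NP_subset_P_iff_hasPConstructiveSeparation {S : Language Bool} (hS : IsNPComplete S) :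
    ¬ Nondeterministic.NP ⊆ Classes.P ↔
      ∀ L : Language Bool, IsNPComplete L → IsLengthPaddable L →
        HasPConstructiveSeparation L Classes.P := by
  constructor
  · exact fun hNP L hL hpad => pConstructiveSeparation_of_not_NP_subset_P_holds hNP L hL hpad
  · intro h hsub
    have hsep := h (onesZeroPad S) (isNPComplete_onesZeroPad hS) (isLengthPaddable_onesZeroPad S)
    exact not_mem_of_hasPConstructiveSeparation hsep (hsub (isNPComplete_onesZeroPad hS).mem)

end Literature.Computability.MetaComplexity
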